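import Literature.Analysis.ODE.CompactSupportFlow
import Mathlib.Analysis.Calculus.MeanValue
import HarnessLib

/-!
# The vector-field method for a family of functions: straightening `F(s, ·)` to `F(0, ·)` by the
# flow of a field correcting a transverse direction (Moser's trick for functions, flat form)

General differential topology (topic `Geometry/Manifold`, next to `VectorSpaceGlobalFlow.lean`),
proofs only.  On a real Banach space `E`, with the time-dependent flow `tdFlow` of a compactly
supported field (`Literature/Analysis/ODE/CompactSupportFlow.lean`, Hirsch (1976), Ch. 8 §1), the
classical remark behind "nearby fibrations are isotopic" / Moser's method (Moser 1965; Lee,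
*Introduction to Smooth Manifolds* (2012), proof of Thm. 17.25 pattern; Geiges, *An Introduction to
Contact Topology* (2008), §2.2 "the Moser trick"): for a `C¹` family of functions `F : ℝ × E → G`
and a time-dependent field `X` with

  `∂ₛF(s, x) + D_xF(s, x) · X(s, x) = 0`, i.e. `DF(s, x)(1, X(s, x)) = 0`,

the flow `φ_{t₀,s}` of `X` carries `F(t₀, ·)` to `F(s, ·)`: **`F(s, φ_{t₀,s} x) = F(t₀, x)`**
(`apply_tdFlow_eq_of_fderiv_eq_zero`; the graph `s ↦ (s, φ s x)` has velocity `(1, X)`, so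
`F ∘ graph` has derivative `0`).  The field is manufactured from a direction field `R` TRANSVERSE to
the levels (`D_xF(s,x)(R x) ≠ 0` where needed) and an arbitrary "drift" `V`:

  `X = V + f R`,  `f = -(∂ₛF + D_xF(V)) · g`,  `g · D_xF(R) = 1` wherever `∂ₛF + D_xF(V) ≠ 0`

(`straighteningField`, `fderiv_apply_one_straighteningField`: the identity above holds;
`contDiff_straighteningField`; the user supplies the normalised inverse `g`, typically a cut-off
divided by `D_xF(R)`), and the drift is what lets the flow TRACK prescribed curves: if `c : ℝ → E`
moves inside the moving level sets (`F(s, c s)` constant) with velocity `V(s, c s)`, then the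
correction vanishes along `c` and **the flow carries `c 0` to `c s`** (`tdFlow_apply_eq_curve`,
uniqueness of solutions).  Use (the seat's purpose): `F(s, ·)` a family of page fibrations of an open
book on a hypersurface of `ℝ⁴`, `R` a Reeb field transverse to the pages, `V` the velocity of an
isotopy of curves kept inside pages — the end map intertwines the two fibrations and carries curve to
curve (Etnyre 2006, proof of Thm. 5.5, "glue up the Reeb vector fields"; Legendrian repositioning in
`Geometry/Symplectic/LefschetzSteinOpenBookBaseTransport.lean`).  Also recorded: a function
annihilated by `X` at all times is preserved (`apply_tdFlow_eq_of_fderiv_comp_eq_zero`, first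
integrals — e.g. the level function of the hypersurface, so that the flow restricts to it).

Everything is proved; one definition (`straighteningField`, an explicit formula), no named fact.

## References

* J. Moser, *On the volume elements on a manifold*, Trans. AMS 120 (1965), 286–294. [Moser1965]
* M. W. Hirsch, *Differential Topology*, GTM 33 (1976), Ch. 8 §1, Thms. 1.1–1.2. [Hirsch1976]
* H. Geiges, *An Introduction to Contact Topology* (2008), §2.2. [Geiges2008]
* J. B. Etnyre, *Lectures on open book decompositions and contact structures*, Clay Math. Proc. 5
  (2006), proof of Thm. 5.5. [Etnyre2006]
-/

open scoped Topology ContDiff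
open Set Function Filter

noncomputable section

namespace Literature.Geometry.Manifold

open Literature.Analysis.ODE

universe u

variable {E : Type u} [NormedAddCommGroup E] [NormedSpace ℝ E] [CompleteSpace E]
  {G : Type*} [NormedAddCommGroup G] [NormedSpace ℝ G]
  {n : ℕ∞} {X : ℝ × E → E}

/-! ### Families of functions constant along the flow -/

/-- The graph `s ↦ (s, φ_{t₀,s} x)` of a flow line has velocity `(1, X(s, φ_{t₀,s} x))`.
[folklore] -/
theorem hasDerivAt_graph_tdFlow (hX : ContDiff ℝ n X) (hsupp : HasCompactSupport X) (hn : 1 ≤ n)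
    (t₀ : ℝ) (x : E) (s : ℝ) :
    HasDerivAt (fun s => ((s, tdFlow hX hsupp hn t₀ s x) : ℝ × E))
      ((1 : ℝ), X (s, tdFlow hX hsupp hn t₀ s x)) s :=
  (hasDerivAt_id s).prodMk (hasDerivAt_tdFlow hX hsupp hn t₀ x s)

/-- **A family of functions with `DF(s,x)(1, X(s,x)) = 0` is carried along the flow of `X`:
`F(s, φ_{t₀,s} x) = F(t₀, x)`.**  (`∂ₛF + D_xF · X = 0` says that `F` is a first integral of the
suspension `(1, X)` on `ℝ × E`.) [cite: Hirsch1976, Ch. 8 §1, Thm. 1.1] -/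
theorem apply_tdFlow_eq_of_fderiv_eq_zero (hX : ContDiff ℝ n X) (hsupp : HasCompactSupport X)
    (hn : 1 ≤ n) {F : ℝ × E → G} (hF : Differentiable ℝ F)
    (hFX : ∀ p : ℝ × E, fderiv ℝ F p ((1 : ℝ), X p) = 0) (t₀ s : ℝ) (x : E) :
    F (s, tdFlow hX hsupp hn t₀ s x) = F (t₀, x) := by
  have hd : ∀ r, HasDerivAt (fun r => F (r, tdFlow hX hsupp hn t₀ r x)) (0 : G) r := fun r => by
    have h := (hF (r, tdFlow hX hsupp hn t₀ r x)).hasFDerivAt.comp_hasDerivAt r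
      (hasDerivAt_graph_tdFlow hX hsupp hn t₀ x r)
    rw [hFX] at h
    exact h
  have hconst := is_const_of_deriv_eq_zero (f := fun r => F (r, tdFlow hX hsupp hn t₀ r x))
    (fun r => (hd r).differentiableAt) (fun r => (hd r).deriv) s t₀
  simpa using hconst

/-- **A time-independent first integral is preserved**: if `D H(x)(X(s, x)) = 0` for all `s, x`
then `H(φ_{t₀,s} x) = H x` (e.g. the level function of a hypersurface to which `X` is tangent, so
that the flow preserves each of its levels). [cite: Hirsch1976, Ch. 8 §1, Thm. 1.1] -/
theorem apply_tdFlow_eq_of_fderiv_comp_eq_zero (hX : ContDiff ℝ n X) (hsupp : HasCompactSupport X)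
    (hn : 1 ≤ n) {H : E → G} (hH : Differentiable ℝ H)
    (hHX : ∀ (s : ℝ) (x : E), fderiv ℝ H x (X (s, x)) = 0) (t₀ s : ℝ) (x : E) :
    H (tdFlow hX hsupp hn t₀ s x) = H x := by
  have hF : Differentiable ℝ fun p : ℝ × E => H p.2 := hH.comp differentiable_snd
  have key := apply_tdFlow_eq_of_fderiv_eq_zero hX hsupp hn hF (fun p => ?_) t₀ s x
  · simpa using key
  · have : fderiv ℝ (fun p : ℝ × E => H p.2) p = (fderiv ℝ H p.2).comp (ContinuousLinearMap.snd ℝ ℝ E) := by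
      rw [show (fun p : ℝ × E => H p.2) = H ∘ Prod.snd from rfl,
        fderiv_comp p (hH p.2) differentiableAt_snd, fderiv_snd]
    rw [this]
    simpa using hHX p.1 p.2

/-- The flow maps each level set `{F(t₀, ·) = c}` into the level set `{F(s, ·) = c}` (set form
of `apply_tdFlow_eq_of_fderiv_eq_zero`). [folklore] -/
theorem mapsTo_tdFlow_level (hX : ContDiff ℝ n X) (hsupp : HasCompactSupport X) (hn : 1 ≤ n)
    {F : ℝ × E → G} (hF : Differentiable ℝ F)
    (hFX : ∀ p : ℝ × E, fderiv ℝ F p ((1 : ℝ), X p) = 0) (t₀ s : ℝ) (c : G) :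
    MapsTo (tdFlow hX hsupp hn t₀ s) {x | F (t₀, x) = c} {x | F (s, x) = c} := fun x hx => by
  simp only [mem_setOf_eq] at hx ⊢
  rw [apply_tdFlow_eq_of_fderiv_eq_zero hX hsupp hn hF hFX, hx]

/-! ### The straightening field `X = V + f R` -/

section Field

variable {F : ℝ × E → G} {R : E → E} {V : ℝ × E → E} {g : ℝ × E → G →L[ℝ] ℝ}

/-- **The straightening field** `X(s, x) = V(s, x) - g(s,x)(∂ₛF(s,x) + D_xF(s,x) V(s,x)) • R x`:
the drift `V` corrected in the transverse direction `R` so as to annihilate `(1, X)` under `DF`,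
`g(s, x)` being a (cut-off) left inverse of `λ ↦ λ • D_xF(s,x)(R x)` on the relevant set.  For
real-valued `F` (`G = ℝ`), `g` is multiplication by a cut-off divided by `D_xF(R)`.
[cite: Geiges2008, §2.2] -/
def straighteningField (F : ℝ × E → G) (R : E → E) (V : ℝ × E → E) (g : ℝ × E → G →L[ℝ] ℝ)
    (p : ℝ × E) : E :=
  V p - (g p (fderiv ℝ F p ((1 : ℝ), V p))) • R p.2

omit [CompleteSpace E] in
/-- Unfolding. [folklore] -/
theorem straighteningField_apply (F : ℝ × E → G) (R : E → E) (V : ℝ × E → E)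
    (g : ℝ × E → G →L[ℝ] ℝ) (p : ℝ × E) :
    straighteningField F R V g p = V p - (g p (fderiv ℝ F p ((1 : ℝ), V p))) • R p.2 := rfl

omit [CompleteSpace E] in
/-- **The defining identity**: wherever either the uncorrected derivative
`a = DF(s,x)(1, V) = ∂ₛF + D_xF(V)` vanishes or `g(s,x)` inverts `λ ↦ λ • D_xF(s,x)(R x)` at `a`
(`g a • D_xF(R) = a`), the field satisfies `DF(s,x)(1, X(s,x)) = 0`. [cite: Geiges2008, §2.2] -/
theorem fderiv_apply_one_straighteningField (p : ℝ × E)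
    (h : fderiv ℝ F p ((1 : ℝ), V p) = 0 ∨
      (g p (fderiv ℝ F p ((1 : ℝ), V p))) • fderiv ℝ F p ((0 : ℝ), R p.2) =
        fderiv ℝ F p ((1 : ℝ), V p)) :
    fderiv ℝ F p ((1 : ℝ), straighteningField F R V g p) = 0 := by
  have hsplit : ((1 : ℝ), straighteningField F R V g p) =
      ((1 : ℝ), V p) - (g p (fderiv ℝ F p ((1 : ℝ), V p))) • ((0 : ℝ), R p.2) := by
    ext <;> simp [straighteningField_apply]
  rw [hsplit, map_sub, map_smul]
  rcases h with h | h
  · rw [h, map_zero, zero_smul, sub_zero]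
  · rw [h, sub_self]

omit [CompleteSpace E] in
/-- Where the drift and the `s`-derivative of `F` both vanish, so does the field (so the flow is
the identity there, `tdFlow_eq_self_of_forall_eq_zero`). [folklore] -/
theorem straighteningField_eq_zero (p : ℝ × E) (hV : V p = 0)
    (hF : fderiv ℝ F p ((1 : ℝ), (0 : E)) = 0) : straighteningField F R V g p = 0 := by
  rw [straighteningField_apply, hV, hF, map_zero, zero_smul, sub_zero]

omit [CompleteSpace E] in
/-- **Smoothness of the straightening field** from that of its ingredients (`F` of class
`C^{n+1}` so that `DF` is `C^n`). [folklore] -/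
theorem contDiff_straighteningField {m : ℕ∞} (hF : ContDiff ℝ (m + 1) F)
    (hR : ContDiff ℝ m R) (hV : ContDiff ℝ m V) (hg : ContDiff ℝ m g) :
    ContDiff ℝ m (straighteningField F R V g) := by
  have hdF : ContDiff ℝ m (fderiv ℝ F) := hF.fderiv_right le_rfl
  have ha : ContDiff ℝ m fun p : ℝ × E => fderiv ℝ F p ((1 : ℝ), V p) :=
    hdF.clm_apply (contDiff_const.prodMk hV)
  have hga : ContDiff ℝ m fun p : ℝ × E => g p (fderiv ℝ F p ((1 : ℝ), V p)) := hg.clm_apply ha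
  exact hV.sub (hga.smul (hR.comp contDiff_snd))

omit [CompleteSpace E] in
/-- The straightening field vanishes off the union of the supports of the drift and of
`p ↦ g p` — in particular it has compact support when both do. [folklore] -/
theorem hasCompactSupport_straighteningField (hV : HasCompactSupport V)
    (hg : HasCompactSupport g) : HasCompactSupport (straighteningField F R V g) := by
  have hc : HasCompactSupport fun p : ℝ × E => g p (fderiv ℝ F p ((1 : ℝ), V p)) := by
    refine hg.mono ?_
    intro p hp
    rw [mem_support] at hp ⊢
    intro h0
    exact hp (by rw [h0]; rfl)
  have h2 : HasCompactSupport fun p : ℝ × E => (g p (fderiv ℝ F p ((1 : ℝ), V p))) • R p.2 :=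
    hc.smul_right (f' := fun p : ℝ × E => R p.2)
  exact hV.sub h2

end Field

/-! ### Tracking curves that move inside the levels -/

/-- **Uniqueness form of tracking**: a `C¹` curve `c` solving `c' = X(s, c s)` is carried by the
flow, `φ_{0,s}(c 0) = c s` for all `s`. [cite: Hirsch1976, Ch. 8 §1, Thm. 1.1] -/
theorem tdFlow_apply_eq_of_hasDerivAt (hX : ContDiff ℝ n X) (hsupp : HasCompactSupport X)
    (hn : 1 ≤ n) {c : ℝ → E} (hc : ∀ s, HasDerivAt c (X (s, c s)) s) (s : ℝ) :
    tdFlow hX hsupp hn 0 s (c 0) = c s := by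
  have hT : 0 < |s| + 1 := by positivity
  exact tdFlow_eq_of_hasDerivAt hX hsupp hn (a := -(|s| + 1)) (b := |s| + 1) (t₀ := 0)
    ⟨by linarith, hT⟩ (fun r _ => hc r)
    ⟨by cases abs_cases s <;> linarith, by cases abs_cases s <;> linarith⟩

omit [CompleteSpace E] in
/-- **Along a curve moving inside the moving levels with the drift velocity, the correction
vanishes**: if `F(s, c s)` is constant and `c' s = V(s, c s)`, then
`DF(s, c s)(1, V(s, c s)) = 0`. [folklore] -/
theorem fderiv_apply_one_drift_eq_zero_of_curve {F : ℝ × E → G} (hF : Differentiable ℝ F)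
    {V : ℝ × E → E} {c : ℝ → E} (hc : ∀ s, HasDerivAt c (V (s, c s)) s)
    (hconst : ∀ s, F (s, c s) = F (0, c 0)) (s : ℝ) :
    fderiv ℝ F (s, c s) ((1 : ℝ), V (s, c s)) = 0 := by
  have h1 : HasDerivAt (fun r => F (r, c r)) (fderiv ℝ F (s, c s) ((1 : ℝ), V (s, c s))) s :=
    (hF (s, c s)).hasFDerivAt.comp_hasDerivAt s ((hasDerivAt_id s).prodMk (hc s))
  have h2 : HasDerivAt (fun r => F (r, c r)) (0 : G) s := by
    have : (fun r => F (r, c r)) = fun _ => F (0, c 0) := funext hconst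
    rw [this]
    exact hasDerivAt_const s _
  exact h1.unique h2

/-- **The straightening flow tracks curves moving inside the levels with the drift velocity.**
If `F(s, c s)` is constant in `s` and `c' s = V(s, c s)`, then the flow of the straightening field
`X = V + f R` carries `c 0` to `c s`: along `c` the correction vanishes, so `c` is an integral
curve of `X`. [cite: Geiges2008, §2.2] -/
theorem tdFlow_straighteningField_apply_eq_curve {F : ℝ × E → G} {R : E → E} {V : ℝ × E → E}
    {g : ℝ × E → G →L[ℝ] ℝ}
    (hX : ContDiff ℝ n (straighteningField F R V g))
    (hsupp : HasCompactSupport (straighteningField F R V g)) (hn : 1 ≤ n)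
    (hF : Differentiable ℝ F) {c : ℝ → E} (hc : ∀ s, HasDerivAt c (V (s, c s)) s)
    (hconst : ∀ s, F (s, c s) = F (0, c 0)) (s : ℝ) :
    tdFlow hX hsupp hn 0 s (c 0) = c s := by
  refine tdFlow_apply_eq_of_hasDerivAt hX hsupp hn (fun r => ?_) s
  have h0 := fderiv_apply_one_drift_eq_zero_of_curve hF hc hconst r
  have : straighteningField F R V g (r, c r) = V (r, c r) := by
    rw [straighteningField_apply, h0, map_zero, zero_smul, sub_zero]
  rw [this]
  exact hc r

/-! ### The package -/

/-- **Straightening a family of functions along a transverse field, with curve tracking.**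
Let `F : ℝ × E → G` be `C^{n+1}`, `R : E → E`, `V : ℝ × E → E`, `g : ℝ × E → (G →L[ℝ] ℝ)` be
`C^n` (`n ≥ 1`), `V` and `g` compactly supported, and suppose that at every `(s, x)` either
`a := DF(s,x)(1, V) = 0` or `g(s,x)(a) • D_xF(s,x)(R x) = a` (the correction inverts the
transverse derivative where a correction is needed).  Then the evolution maps `φₛ := φ_{0,s}` of
`X = V - g(∂ₛF + D_xF V) R` are diffeomorphisms of `E` with:
(i) `F(s, φₛ x) = F(0, x)` — `φₛ` carries the levels of `F(0,·)` onto those of `F(s,·)`;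
(ii) `φₛ x = x` wherever `V(r, x) = 0` and `∂ₛF(r, x) = 0` for all `r`;
(iii) every `C¹` curve `c` with `F(s, c s)` constant and `c' = V(s, c s)` is tracked:
`φₛ (c 0) = c s`. [cite: Geiges2008, §2.2] [cite: Hirsch1976, Ch. 8 §1, Thm. 1.1] -/
theorem exists_straightening {F : ℝ × E → G} {R : E → E} {V : ℝ × E → E}
    {g : ℝ × E → G →L[ℝ] ℝ} {m : ℕ∞} (hm : 1 ≤ m) (hF : ContDiff ℝ (m + 1) F)
    (hR : ContDiff ℝ m R) (hV : ContDiff ℝ m V) (hg : ContDiff ℝ m g)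
    (hVs : HasCompactSupport V) (hgs : HasCompactSupport g)
    (hinv : ∀ p : ℝ × E, fderiv ℝ F p ((1 : ℝ), V p) = 0 ∨
      (g p (fderiv ℝ F p ((1 : ℝ), V p))) • fderiv ℝ F p ((0 : ℝ), R p.2) =
        fderiv ℝ F p ((1 : ℝ), V p)) :
    ∃ φ : ℝ → E → E,
      (∀ s, ContDiff ℝ m (φ s)) ∧ (∀ s, Bijective (φ s)) ∧ (∀ x, φ 0 x = x) ∧
      (∀ s x, F (s, φ s x) = F (0, x)) ∧
      (∀ x, (∀ r, V (r, x) = 0) → (∀ r, fderiv ℝ F (r, x) ((1 : ℝ), (0 : E)) = 0) →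
        ∀ s, φ s x = x) ∧
      (∀ c : ℝ → E, (∀ s, HasDerivAt c (V (s, c s)) s) → (∀ s, F (s, c s) = F (0, c 0)) →
        ∀ s, φ s (c 0) = c s) := by
  have hX : ContDiff ℝ m (straighteningField F R V g) := contDiff_straighteningField hF hR hV hg
  have hsupp : HasCompactSupport (straighteningField F R V g) :=
    hasCompactSupport_straighteningField hVs hgs
  have hFd : Differentiable ℝ F := hF.differentiable (by simp)
  refine ⟨fun s => tdFlow hX hsupp hm 0 s, fun s => contDiff_tdFlow_apply hX hsupp hm 0 s,
    fun s => (tdFlowDiffeomorph hX hsupp hm 0 s).bijective, fun x => tdFlow_self hX hsupp hm 0 x,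
    fun s x => ?_, fun x hVx hFx s => ?_, fun c hc hconst s => ?_⟩
  · exact apply_tdFlow_eq_of_fderiv_eq_zero hX hsupp hm hFd
      (fun p => fderiv_apply_one_straighteningField p (hinv p)) 0 s x
  · exact tdFlow_eq_self_of_forall_eq_zero hX hsupp hm
      (fun r => straighteningField_eq_zero (r, x) (hVx r) (hFx r)) 0 s
  · exact tdFlow_straighteningField_apply_eq_curve hX hsupp hm hFd hc hconst s

/-! ### Real-valued families: the cut-off inverse `χ / D_xF(R)` -/

section Real

omit [CompleteSpace E] in
/-- **A smooth function divided by a function which does not vanish on its topological support is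
smooth** (off the support the quotient is locally `0`). [folklore] -/
theorem contDiff_div_of_ne_zero_on_tsupport {m : ℕ∞} {χ q : ℝ × E → ℝ} (hχ : ContDiff ℝ m χ)
    (hq : ContDiff ℝ m q) (h : ∀ p ∈ tsupport χ, q p ≠ 0) :
    ContDiff ℝ m fun p => χ p / q p := by
  rw [contDiff_iff_contDiffAt]
  intro p
  by_cases hp : p ∈ tsupport χ
  · exact hχ.contDiffAt.div hq.contDiffAt (h p hp)
  · have h0 : χ =ᶠ[𝓝 p] 0 := notMem_tsupport_iff_eventuallyEq.1 hp
    have : (fun p => χ p / q p) =ᶠ[𝓝 p] fun _ => 0 := by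
      filter_upwards [h0] with x hx
      simp [hx]
    exact (contDiffAt_const (c := (0 : ℝ))).congr_of_eventuallyEq this

/-- **The cut-off inverse** `g(s, x) = (χ(s,x) / D_xF(s,x)(R x)) · id_ℝ`: multiplication by the
cut-off `χ` divided by the transverse derivative. [folklore] -/
def cutoffInverse (F : ℝ × E → ℝ) (R : E → E) (χ : ℝ × E → ℝ) (p : ℝ × E) : ℝ →L[ℝ] ℝ :=
  (χ p / fderiv ℝ F p ((0 : ℝ), R p.2)) • ContinuousLinearMap.id ℝ ℝ

omit [CompleteSpace E] in
/-- Unfolding: `g(p)(a) = χ(p) / D_xF(p)(R) * a`. [folklore] -/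
@[simp] theorem cutoffInverse_apply (F : ℝ × E → ℝ) (R : E → E) (χ : ℝ × E → ℝ) (p : ℝ × E)
    (a : ℝ) : cutoffInverse F R χ p a = χ p / fderiv ℝ F p ((0 : ℝ), R p.2) * a := by
  simp [cutoffInverse]

omit [CompleteSpace E] in
/-- The cut-off inverse is smooth when `χ` is, `F` is `C^{m+1}`, `R` is `C^m`, and the transverse
derivative `D_xF(R)` does not vanish on the topological support of `χ`. [folklore] -/
theorem contDiff_cutoffInverse {m : ℕ∞} {F : ℝ × E → ℝ} {R : E → E} {χ : ℝ × E → ℝ}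
    (hF : ContDiff ℝ (m + 1) F) (hR : ContDiff ℝ m R) (hχ : ContDiff ℝ m χ)
    (hne : ∀ p ∈ tsupport χ, fderiv ℝ F p ((0 : ℝ), R p.2) ≠ 0) :
    ContDiff ℝ m (cutoffInverse F R χ) := by
  have hdF : ContDiff ℝ m (fderiv ℝ F) := hF.fderiv_right le_rfl
  have hq : ContDiff ℝ m fun p : ℝ × E => fderiv ℝ F p ((0 : ℝ), R p.2) :=
    hdF.clm_apply (contDiff_const.prodMk (hR.comp contDiff_snd))
  exact (contDiff_div_of_ne_zero_on_tsupport hχ hq hne).smul contDiff_const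

omit [CompleteSpace E] in
/-- The cut-off inverse is supported in the support of `χ`. [folklore] -/
theorem hasCompactSupport_cutoffInverse {F : ℝ × E → ℝ} {R : E → E} {χ : ℝ × E → ℝ}
    (hχ : HasCompactSupport χ) : HasCompactSupport (cutoffInverse F R χ) := by
  refine hχ.mono ?_
  intro p hp
  rw [mem_support] at hp ⊢
  intro h0
  apply hp
  ext
  simp [cutoffInverse, h0]

omit [CompleteSpace E] in
/-- Where `χ = 1` (and hence `D_xF(R) ≠ 0`) the cut-off inverse inverts:
`g(a) • D_xF(R) = a`. [folklore] -/
theorem cutoffInverse_smul_eq {F : ℝ × E → ℝ} {R : E → E} {χ : ℝ × E → ℝ} {p : ℝ × E}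
    (hχ : χ p = 1) (hne : fderiv ℝ F p ((0 : ℝ), R p.2) ≠ 0) (a : ℝ) :
    (cutoffInverse F R χ p a) • fderiv ℝ F p ((0 : ℝ), R p.2) = a := by
  rw [cutoffInverse_apply, hχ, smul_eq_mul]
  field_simp

/-- **Straightening a real-valued family along a transverse field with a cut-off, with curve
tracking.**  Let `F : ℝ × E → ℝ` be `C^{n+1}`, `R`, `V`, `χ` be `C^n` (`n ≥ 1`), `V` and `χ`
compactly supported, `D_xF(R) ≠ 0` on the topological support of `χ`, and suppose that at every
`(s, x)` either `∂ₛF + D_xF(V) = 0` or `χ = 1` (a correction is only needed where the cut-off is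
on).  Then the evolution maps `φₛ` of `X = V - χ (∂ₛF + D_xF V)/D_xF(R) · R` are diffeomorphisms
of `E` with `F(s, φₛ x) = F(0, x)`, `φₛ = id` where `V ≡ 0` and `∂ₛF ≡ 0`, and tracking every
`C¹` curve `c` with `F(s, c s)` constant and `c' = V(s, c s)`: `φₛ (c 0) = c s`.
[cite: Geiges2008, §2.2] [cite: Hirsch1976, Ch. 8 §1, Thm. 1.1] -/
theorem exists_straightening_real {F : ℝ × E → ℝ} {R : E → E} {V : ℝ × E → E} {χ : ℝ × E → ℝ}
    {m : ℕ∞} (hm : 1 ≤ m) (hF : ContDiff ℝ (m + 1) F) (hR : ContDiff ℝ m R)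
    (hV : ContDiff ℝ m V) (hχ : ContDiff ℝ m χ) (hVs : HasCompactSupport V)
    (hχs : HasCompactSupport χ)
    (hne : ∀ p ∈ tsupport χ, fderiv ℝ F p ((0 : ℝ), R p.2) ≠ 0)
    (hχ1 : ∀ p : ℝ × E, fderiv ℝ F p ((1 : ℝ), V p) = 0 ∨ χ p = 1) :
    ∃ φ : ℝ → E → E,
      (∀ s, ContDiff ℝ m (φ s)) ∧ (∀ s, Bijective (φ s)) ∧ (∀ x, φ 0 x = x) ∧
      (∀ s x, F (s, φ s x) = F (0, x)) ∧
      (∀ x, (∀ r, V (r, x) = 0) → (∀ r, fderiv ℝ F (r, x) ((1 : ℝ), (0 : E)) = 0) →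
        ∀ s, φ s x = x) ∧
      (∀ c : ℝ → E, (∀ s, HasDerivAt c (V (s, c s)) s) → (∀ s, F (s, c s) = F (0, c 0)) →
        ∀ s, φ s (c 0) = c s) := by
  refine exists_straightening (g := cutoffInverse F R χ) hm hF hR hV
    (contDiff_cutoffInverse hF hR hχ hne) hVs (hasCompactSupport_cutoffInverse hχs) fun p => ?_
  rcases hχ1 p with h | h
  · exact Or.inl h
  · exact Or.inr (cutoffInverse_smul_eq h (hne p (subset_tsupport _ (by
      rw [mem_support, h]; exact one_ne_zero))) _)

end Real

end Literature.Geometry.Manifold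

end
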